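import Summits.RiemannHypothesis.RiemannHypothesis.Theses.SpectralTrace
import Literature.Analysis.DeBrangesSpaces.HalfPlaneCauchy
import Literature.Analysis.Fourier.PaleyWienerSchwartzBounded
import Literature.NumberTheory.LFunctions.WeilMellinInversion
import HarnessLib

/-!
# Aliasing integrals vanish by a contour shift (`stub_hbContour`)

Stub `stub_hbContour` of the line `Sketch` of the crux `SpectralThesis`
(stmt-RiemannHypothesis-0187): for `J` holomorphic at every point of the closed upper half-plane
with `‖J‖ ≤ 1` there, `b > 0`, `ε > 0`, `n ≥ 1` and a Weil test `G` supported in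
`[-(2b-ε), 2b-ε]`,

  `∫_ℝ Ĝ(x) (e^{2ibx} J(x))^n dx = 0`,   `Ĝ(x) = weilMellin G (1/2 + xI) = ∫ G(y) e^{iyx} dy`.

## Proof

`Ĝ(z) = weilMellin G (1/2 + zI) = ∫ G(ξ) e^{2πi (z/2π) ξ} dξ` is entire
(`differentiable_weilMellin`), and two integrations by parts
(`PaleyWienerSchwartz.norm_integral_mul_cexp_le_of_contDiff` with `w = z/(2π)`, `R = 2b - ε`) give
`|Ĝ(x + iη)| ≤ e^{(2b-ε)|η|} (‖G‖₁ + ‖G''‖₁)/(1 + (x/2π)²)`. Since `|e^{2ibz}| = e^{-2bη}` and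
`|J| ≤ 1`, the integrand `h(z) = Ĝ(z) (e^{2ibz} J(z))^n` satisfies, for `η = Im z ≥ 0` and `n ≥ 1`,
`‖h(z)‖ ≤ (‖G‖₁ + ‖G''‖₁) e^{-εη}/(1 + (x/2π)²)`, which is integrable on `ℝ` and
`O(1/(√η ‖z‖))` in the open upper half-plane; the contour lemma
`Literature.Analysis.DeBrangesSpaces.integral_eq_zero_of_decay` (Cauchy–Goursat on the squares
`[-R, R] × [0, R]`) gives `∫_ℝ h = 0`.

All ingredients are classical (folklore); the tree files cited above carry the references
(Hörmander ALPDO I Thm. 7.3.1 for the Paley–Wiener kernel bound; Conrey–Li 2000 §2 for the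
half-plane Cauchy theorem).
-/

noncomputable section

set_option linter.dupNamespace false

open Complex Set MeasureTheory Filter Topology
open scoped Real
open Literature.NumberTheory.LFunctions

namespace Summit.RiemannHypothesis.RiemannHypothesis.Theorems.SpectralThesis.Sketch

/-- `Ĝ(1/2 + zI)` is the Fourier–Laplace integral `∫ G(ξ) e^{2πi (z/2π) ξ} dξ`. [folklore] -/
theorem weilMellin_half_add_mul_I (G : ℝ → ℂ) (z : ℂ) :
    weilMellin G (1 / 2 + z * I) = ∫ ξ : ℝ, G ξ * cexp (2 * π * I * (z / (2 * π)) * ξ) := by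
  unfold weilMellin
  congr 1 with ξ
  congr 2
  have hπ : (π : ℂ) ≠ 0 := ofReal_ne_zero.2 Real.pi_ne_zero
  field_simp
  ring

/-- **Paley–Wiener bound for `Ĝ` off the real axis.** For a Weil test `G` supported in
`[-R, R]`: `‖Ĝ(1/2 + zI)‖ ≤ e^{R |Im z|} (‖G‖₁ + ‖G''‖₁)/(1 + (Re z/2π)²)` (two integrations by
parts). [folklore] -/
theorem norm_weilMellin_half_add_mul_I_le {G : ℝ → ℂ} (hG : IsWeilTest G) {R : ℝ}
    (hGs : tsupport G ⊆ Icc (-R) R) (z : ℂ) :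
    ‖weilMellin G (1 / 2 + z * I)‖ ≤
      Real.exp (R * |z.im|) * ((∫ ξ : ℝ, ‖G ξ‖) + ∫ ξ : ℝ, ‖deriv (deriv G) ξ‖) /
        (1 + (z.re / (2 * π)) ^ 2) := by
  rw [weilMellin_half_add_mul_I]
  have h := Literature.Analysis.Fourier.PaleyWienerSchwartz.norm_integral_mul_cexp_le_of_contDiff
    hG.1 hG.2 hGs (z / (2 * π))
  have h2π : (2 * π : ℂ) = ((2 * π : ℝ) : ℂ) := by push_cast; ring
  have hre : (z / (2 * π)).re = z.re / (2 * π) := by rw [h2π, div_ofReal_re]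
  have him : (z / (2 * π)).im = z.im / (2 * π) := by rw [h2π, div_ofReal_im]
  have habs : 2 * π * R * |z.im / (2 * π)| = R * |z.im| := by
    rw [abs_div, abs_of_pos (by positivity : (0 : ℝ) < 2 * π)]
    field_simp
  rwa [hre, him, habs] at h

/-- The main estimate, decay, and the contour shift. -/
theorem stub_hbContour {b ε : ℝ} (hb : 0 < b) (hε : 0 < ε) {J : ℂ → ℂ}
    (hJd : ∀ z : ℂ, 0 ≤ z.im → DifferentiableAt ℂ J z)
    (hJb : ∀ z : ℂ, 0 ≤ z.im → ‖J z‖ ≤ 1)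
    {n : ℕ} (hn : 1 ≤ n) {G : ℝ → ℂ} (hG : IsWeilTest G)
    (hGs : tsupport G ⊆ Set.Icc (-(2 * b - ε)) (2 * b - ε)) :
    ∫ x : ℝ, weilMellin G (1 / 2 + x * I) * (Complex.exp (2 * I * b * x) * J x) ^ n = 0 := by
  set M : ℝ := (∫ ξ : ℝ, ‖G ξ‖) + ∫ ξ : ℝ, ‖deriv (deriv G) ξ‖ with hM
  have hM0 : 0 ≤ M :=
    add_nonneg (integral_nonneg fun _ ↦ norm_nonneg _) (integral_nonneg fun _ ↦ norm_nonneg _)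
  set h : ℂ → ℂ := fun z ↦ weilMellin G (1 / 2 + z * I) * (cexp (2 * I * b * z) * J z) ^ n
    with hh
  -- the oscillatory factor: `‖(e^{2ibz} J z)^n‖ ≤ e^{-2b Im z}` on the closed upper half-plane
  have hJn : ∀ z : ℂ, 0 ≤ z.im → ‖(cexp (2 * I * b * z) * J z) ^ n‖ ≤ Real.exp (-(2 * b * z.im)) := by
    intro z hz
    have h2 : ‖cexp (2 * I * b * z)‖ = Real.exp (-(2 * b * z.im)) := by
      rw [norm_exp]
      congr 1
      simp only [mul_re, mul_im, I_re, I_im, ofReal_re, ofReal_im, re_ofNat, im_ofNat]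
      ring
    rw [norm_pow, norm_mul, h2]
    have h0 : 0 < Real.exp (-(2 * b * z.im)) := Real.exp_pos _
    have h4 : Real.exp (-(2 * b * z.im)) * ‖J z‖ ≤ Real.exp (-(2 * b * z.im)) := by
      have := hJb z hz
      nlinarith
    have h5 : Real.exp (-(2 * b * z.im)) ≤ 1 := by
      rw [Real.exp_le_one_iff]
      nlinarith
    calc (Real.exp (-(2 * b * z.im)) * ‖J z‖) ^ n ≤ (Real.exp (-(2 * b * z.im))) ^ n :=
          pow_le_pow_left₀ (by positivity) h4 n
      _ ≤ Real.exp (-(2 * b * z.im)) := pow_le_of_le_one h0.le h5 (by omega)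
  -- pointwise bound on the closed upper half-plane
  have hbound : ∀ z : ℂ, 0 ≤ z.im →
      ‖h z‖ ≤ M * Real.exp (-(ε * z.im)) / (1 + (z.re / (2 * π)) ^ 2) := by
    intro z hz
    have h1 := norm_weilMellin_half_add_mul_I_le hG hGs z
    rw [abs_of_nonneg hz] at h1
    have hpos : 0 < 1 + (z.re / (2 * π)) ^ 2 := by positivity
    calc ‖h z‖ = ‖weilMellin G (1 / 2 + z * I)‖ * ‖(cexp (2 * I * b * z) * J z) ^ n‖ :=
          norm_mul _ _
      _ ≤ Real.exp ((2 * b - ε) * z.im) * M / (1 + (z.re / (2 * π)) ^ 2) *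
            Real.exp (-(2 * b * z.im)) :=
          mul_le_mul h1 (hJn z hz) (norm_nonneg _) (by positivity)
      _ = M * Real.exp (-(ε * z.im)) / (1 + (z.re / (2 * π)) ^ 2) := by
          rw [show -(ε * z.im) = (2 * b - ε) * z.im + -(2 * b * z.im) by ring, Real.exp_add]
          field_simp
  refine Literature.Analysis.DeBrangesSpaces.integral_eq_zero_of_decay (h := h)
    (C := M * (4 + 5 / ε + 2 / ε ^ 2)) (R₀ := 0) (by positivity) ?_ ?_ ?_
  · -- differentiability on the closed upper half-plane
    intro z hz
    have hW : DifferentiableAt ℂ (fun z : ℂ ↦ weilMellin G (1 / 2 + z * I)) z :=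
      ((differentiable_weilMellin hG.1.continuous hG.2).comp
        (by fun_prop : Differentiable ℂ fun z : ℂ ↦ 1 / 2 + z * I)).differentiableAt
    have hE : DifferentiableAt ℂ (fun z : ℂ ↦ cexp (2 * I * b * z)) z := by fun_prop
    exact hW.mul ((hE.mul (hJd z hz)).pow n)
  · -- integrability on `ℝ`
    have hJc : Continuous fun x : ℝ ↦ J x :=
      continuous_iff_continuousAt.2 fun x ↦
        ((hJd x (by simp)).continuousAt).comp Complex.continuous_ofReal.continuousAt
    have hF : Continuous fun x : ℝ ↦ (cexp (2 * I * b * x) * J x) ^ n :=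
      ((by fun_prop : Continuous fun x : ℝ ↦ cexp (2 * I * b * x)).mul hJc).pow n
    have hB : ∀ x : ℝ, ‖(cexp (2 * I * b * x) * J x) ^ n‖ ≤ 1 := fun x ↦ by
      simpa using hJn x (by simp)
    have hi := integrable_weilMellin_vertical_mul hG (1 / 2) hF hB
    push_cast at hi
    exact hi
  · -- the decay bound in the open upper half-plane
    intro z hz _
    have hη := hz.le
    have hsqrt : √z.im ≤ 1 + z.im := by
      rw [Real.sqrt_le_left (by positivity)]
      nlinarith
    have hnorm : ‖z‖ ≤ |z.re| + z.im := by
      have := norm_le_abs_re_add_abs_im z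
      rwa [abs_of_pos hz] at this
    have hD : 1 + z.re ^ 2 / 64 ≤ 1 + (z.re / (2 * π)) ^ 2 := by
      have hπ4 : π ≤ 4 := Real.pi_le_four
      have hπ0 : 0 < π := Real.pi_pos
      rw [div_pow]
      gcongr
      · nlinarith
    have hxD : |z.re| + z.im ≤ (4 + z.im) * (1 + z.re ^ 2 / 64) := by
      have hsq : |z.re| ^ 2 = z.re ^ 2 := sq_abs _
      nlinarith [sq_nonneg (|z.re| / 4 - 2), mul_nonneg hη (sq_nonneg z.re), abs_nonneg z.re]
    have hexp : Real.exp (-(ε * z.im)) * ((1 + z.im) * (4 + z.im)) ≤ 4 + 5 / ε + 2 / ε ^ 2 := by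
      set E := Real.exp (ε * z.im) with hE
      have hq : 1 + ε * z.im + (ε * z.im) ^ 2 / 2 ≤ E :=
        Real.quadratic_le_exp_of_nonneg (by positivity)
      have hE1 : 1 ≤ E := Real.one_le_exp (by positivity)
      have hEpos : 0 < E := Real.exp_pos _
      have h5 : z.im ≤ E / ε := by
        rw [le_div_iff₀ hε]
        nlinarith
      have h6 : z.im ^ 2 ≤ 2 * E / ε ^ 2 := by
        rw [le_div_iff₀ (by positivity)]
        nlinarith
      rw [Real.exp_neg, inv_mul_le_iff₀ hEpos]
      calc (1 + z.im) * (4 + z.im) = 4 + 5 * z.im + z.im ^ 2 := by ring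
        _ ≤ 4 * E + 5 * (E / ε) + 2 * E / ε ^ 2 := by linarith
        _ = E * (4 + 5 / ε + 2 / ε ^ 2) := by ring
    have hDpos : 0 < 1 + (z.re / (2 * π)) ^ 2 := by positivity
    have hzpos : 0 < ‖z‖ := norm_pos_iff.2 (by rintro rfl; simp at hz)
    rw [le_div_iff₀ (by positivity)]
    calc ‖h z‖ * (√z.im * ‖z‖)
        ≤ (M * Real.exp (-(ε * z.im)) / (1 + (z.re / (2 * π)) ^ 2)) *
            ((1 + z.im) * ((4 + z.im) * (1 + (z.re / (2 * π)) ^ 2))) := by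
          apply mul_le_mul (hbound z hη) _ (by positivity) (by positivity)
          calc √z.im * ‖z‖ ≤ (1 + z.im) * (|z.re| + z.im) :=
                mul_le_mul hsqrt hnorm (by positivity) (by positivity)
            _ ≤ (1 + z.im) * ((4 + z.im) * (1 + z.re ^ 2 / 64)) := by gcongr
            _ ≤ (1 + z.im) * ((4 + z.im) * (1 + (z.re / (2 * π)) ^ 2)) := by gcongr
      _ = M * (Real.exp (-(ε * z.im)) * ((1 + z.im) * (4 + z.im))) := by
          field_simp
      _ ≤ M * (4 + 5 / ε + 2 / ε ^ 2) := by gcongr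

end Summit.RiemannHypothesis.RiemannHypothesis.Theorems.SpectralThesis.Sketch

end
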